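import Summits.Ventures.QEC.Thresholds.PlanarThresholdConverses
import Literature.InformationTheory.QuantumCodes.PlanarCodeErasureHalf
import Literature.InformationTheory.QuantumCodes.LossThresholdOneArm
import HarnessLib

/-!
# The LOSS threshold of the PLANAR surface codes is EXACTLY `1/2` — Q5 packaging (KERNEL, unconditional)

Venture QEC, `Summits/Ventures/QEC/Thresholds/` (LADDER-QEC rung Q5; qec-type-03 gen 5, cell item 03.PLANARHALF). All PROVED,
kernel axioms, no named fact, no `native_decide`. Literature side (`PlanarCodeErasureHalfGeometry.lean`,
`PlanarCodeErasureHalf.lean`): a loss pattern of lit-2's `k`-th planar surface code `HGP(H, Hᵀ)` whose lost links support a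
cycle of the sector with an ODD bottom rough crossing produces a one-arm event of `ℤ²` bond percolation, whence
`Prob_y[odd crossing] → 0` for every `y < 1/2` (Kesten's theorem, tree-proved `Kesten1980_expDecay`). This file supplies the
identification with UNCORRECTABILITY — the planar code encodes ONE qubit (`planarHGPCode_k`, Tillich–Zémor Thm 7), so every
non-trivial logical of the sector is the string `x̄` plus a stabilizer and crosses the bottom rough boundary an odd number
of times (`planar_logical_add_string_mem`, `oddCrossing_of_not_isCorrectableErasure`) — and the Q5 statements:

* `planar_lossThreshold_half : IsThresholdLowerBound planarErasureFamily (1/2)` (and the second sector, `…'`);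
* ★ **`planar_erasure_accuracyThreshold_eq_half : accuracyThreshold planarErasureFamily = 1/2`** — with lit-2's no-cloning
  ceiling `planar_erasure_threshold_le_half` (`PlanarThresholdConverses.lean`): the loss threshold of the planar surface codes
  is EXACTLY `1/2` (both sectors; census forms for `z/xErasureFamily (fun k => planarHGPCode k)`), superseding the certified
  interval `1/3 ≤ y_c ≤ 1/2` (Q5 rows A9/F6/F16).

## References

* [StaceBarrettDoherty2009] Stace–Barrett–Doherty, PRL 102 (2009) 200501, arXiv:0904.3556, p. 1 (abstract: "the maximum
  tolerable loss rate is 50%"), p. 2–3.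
* [KestenCMP1980] H. Kesten, Comm. Math. Phys. 74 (1980) 41–59, Thm. 1, Thm. 2 (1.7).
* [TillichZemor2014] J.-P. Tillich, G. Zémor, IEEE Trans. IT 60 (2014) 1193, §3 and Thm 7 (the surface code, k = 1).
-/

noncomputable section

namespace Summit.Ventures.QEC.Thresholds

open Filter Topology Matrix
open Literature.InformationTheory.QuantumCodes
open Literature.InformationTheory.QuantumCodes.PlanarCode

/-! ### One logical qubit: every non-trivial logical is the string plus a stabilizer -/

/-- `dim ker H_X − dim rs H_Z = 1` for the planar code (Tillich–Zémor Thm 7, through `planarHGPCode_k` and the `X ↔ Z`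
symmetry of `k`). [cite: TillichZemor2014, Thm 7 (k of the surface code = 1)] -/
theorem planar_finrank_kerX_sub (k : ℕ) :
    Module.finrank (ZMod 2) (planarHGPCode k).kerX - Module.finrank (ZMod 2) (planarHGPCode k).rowSpZ = 1 := by
  have h := (planarHGPCode k).k_swap
  rw [planarHGPCode_k] at h
  exact h

/-- **Every non-trivial logical of the sector is `x̄` plus a stabilizer** (`k = 1`): if `H_X x = 0` and `x ∉ rs H_Z` then
`x + x̄ ∈ rs H_Z`, `x̄ = planarXString k`. [cite: TillichZemor2014, §3 and Thm 7 (one logical qubit)] -/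
theorem planar_logical_add_string_mem (k : ℕ) {x : PlanarQubit k → ZMod 2} (hx : planarHX k *ᵥ x = 0)
    (hxS : x ∉ (planarHGPCode k).rowSpZ) : x + planarXString k ∈ (planarHGPCode k).rowSpZ := by
  have hWV : (planarHGPCode k).rowSpZ ≤ (planarHGPCode k).kerX := (planarHGPCode k).rowSpZ_le_kerX
  have hsV : planarXString k ∈ (planarHGPCode k).kerX :=
    ((planarHGPCode k).mem_kerX_iff _).2 (planarHX_mulVec_planarXString k)
  have hsW : planarXString k ∉ (planarHGPCode k).rowSpZ := (planarXString_logical k).2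
  have hxV : x ∈ (planarHGPCode k).kerX := ((planarHGPCode k).mem_kerX_iff _).2 hx
  have h3 := planar_finrank_kerX_sub k
  have hW'V : (planarHGPCode k).rowSpZ ⊔ (ZMod 2) ∙ planarXString k ≤ (planarHGPCode k).kerX :=
    sup_le hWV ((Submodule.span_singleton_le_iff_mem _ _).2 hsV)
  have hlt : (planarHGPCode k).rowSpZ < (planarHGPCode k).rowSpZ ⊔ (ZMod 2) ∙ planarXString k := by
    refine lt_of_le_of_ne le_sup_left fun h => hsW ?_
    rw [h]
    exact Submodule.mem_sup_right (Submodule.mem_span_singleton_self _)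
  have h1 := Submodule.finrank_lt_finrank_of_lt hlt
  have h2 := Submodule.finrank_mono hW'V
  have heq : (planarHGPCode k).rowSpZ ⊔ (ZMod 2) ∙ planarXString k = (planarHGPCode k).kerX :=
    Submodule.eq_of_le_of_finrank_eq hW'V (by omega)
  have hxW' : x ∈ (planarHGPCode k).rowSpZ ⊔ (ZMod 2) ∙ planarXString k := heq ▸ hxV
  obtain ⟨w, hw, t, ht, hwt⟩ := Submodule.mem_sup.1 hxW'
  obtain ⟨a, rfl⟩ := Submodule.mem_span_singleton.1 ht
  have hss : planarXString k + planarXString k = 0 := by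
    funext q
    have : ∀ t : ZMod 2, t + t = 0 := by decide
    exact this _
  by_cases ha : a = 0
  · subst ha
    rw [zero_smul, add_zero] at hwt
    exact absurd (hwt ▸ hw) hxS
  · have ha1 : a = 1 := by
      have key : ∀ a : ZMod 2, a ≠ 0 → a = 1 := by decide
      exact key a ha
    subst ha1
    rw [one_smul] at hwt
    rw [← hwt, add_assoc, hss, add_zero]
    exact hw

/-- The bottom rough crossing number of `x` is its pairing with the `Z̄`-cycle `z̄ = planarZString`:
`z̄ · x = Σ_b x(0, b)_L`. [cite: TillichZemor2014, §3 (logical strings of the surface code)] -/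
theorem planarZString_dotProduct (k : ℕ) (x : PlanarQubit k → ZMod 2) :
    planarZString k ⬝ᵥ x = ∑ b : Fin (k + 2), x (Sum.inl (0, b)) := by
  classical
  simp only [dotProduct, planarZString, Fintype.sum_sum_type, Sum.elim_inl, Sum.elim_inr, zero_mul,
    Finset.sum_const_zero, add_zero, Fintype.sum_prod_type, ite_mul, one_mul]
  rw [Finset.sum_eq_single (0 : Fin (k + 2))]
  · simp
  · intro α _ hα
    simp [hα]
  · intro h; exact absurd (Finset.mem_univ _) h

/-- **Uncorrectable ⇒ odd crossing**: an uncorrectable loss pattern of the planar code supports a cycle of the sector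
crossing the bottom rough boundary an odd number of times. [cite: StaceBarrettDoherty2009, p. 2 (a logical operator inside the lost set)] -/
theorem oddCrossing_of_not_isCorrectableErasure (k : ℕ) {Er : Finset (PlanarQubit k)}
    (h : ¬ IsCorrectableErasure {x : PlanarQubit k → ZMod 2 | planarHX k *ᵥ x = 0}
      (planarSZ k : Set (PlanarQubit k → ZMod 2)) Er) : OddCrossing k Er := by
  classical
  unfold IsCorrectableErasure at h
  push Not at h
  obtain ⟨x, hx, hxE, hxS⟩ := h
  refine ⟨x, hx, fun q hq => hxE (by simp [supp, hq]), ?_⟩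
  rw [← planarZString_dotProduct]
  have hmem : x + planarXString k ∈ (planarHGPCode k).rowSpZ := planar_logical_add_string_mem k hx hxS
  have h1 : planarZString k ⬝ᵥ (x + planarXString k) = 0 :=
    dotProduct_eq_zero_of_mem_rowSpace hmem (planarHZ_mulVec_planarZString k)
  have h2 : planarZString k ⬝ᵥ planarXString k = 1 := by
    rw [dotProduct_comm]; exact planarXString_dotProduct_planarZString k
  rw [dotProduct_add, h2] at h1
  have key : ∀ t : ZMod 2, t + 1 = 0 → t = 1 := by decide
  exact key _ h1

/-! ### The loss threshold of the planar surface codes is exactly `1/2` -/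

open Classical in
/-- **Planar loss threshold `≥ 1/2`** (first sector; KERNEL, from Kesten's theorem): every loss rate `0 ≤ y < 1/2` is below
threshold for lit-2's `planarErasureFamily`. [cite: StaceBarrettDoherty2009, p. 2–3 (for p_loss < 0.5 loss recovery succeeds)] -/
theorem planar_lossThreshold_half : IsThresholdLowerBound planarErasureFamily (1 / 2) := by
  intro y hy0 hy
  have hy1 : y ≤ 1 := by linarith
  have h := oddCrossing_isThresholdLowerBound_half y hy0 hy
  refine BelowThreshold.of_le (P := planarErasureFamily) h
    (fun k => ErasureDecoder.uncorrectableProb_nonneg _ _ hy0 hy1) fun k => ?_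
  unfold planarErasureFamily ErasureDecoder.uncorrectableProb
  exact eventProb_mono (fun Er hEr => oddCrossing_of_not_isCorrectableErasure k hEr) hy0 hy1

/-- ★ **THE LOSS THRESHOLD OF THE PLANAR SURFACE CODES IS EXACTLY `1/2`** (first sector): floor `planar_lossThreshold_half`
(Kesten), ceiling lit-2's no-cloning bound `planar_erasure_threshold_le_half`. [cite: StaceBarrettDoherty2009, p. 1 (abstract: maximum tolerable loss rate 50%)] -/
theorem planar_erasure_accuracyThreshold_eq_half : accuracyThreshold planarErasureFamily = 1 / 2 :=
  le_antisymm (planar_erasure_threshold_le_half (isThresholdLowerBound_accuracyThreshold _))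
    (le_accuracyThreshold planar_lossThreshold_half (by norm_num))

/-- **Planar loss threshold `≥ 1/2`**, second sector (`planarErasureFamily' = planarErasureFamily`).
[cite: StaceBarrettDoherty2009, p. 2–3] -/
theorem planar_lossThreshold_half' : IsThresholdLowerBound planarErasureFamily' (1 / 2) := by
  rw [planarErasureFamily'_eq]
  exact planar_lossThreshold_half

/-- ★ **Second sector: loss threshold EXACTLY `1/2`.** [cite: StaceBarrettDoherty2009, p. 1 (abstract)] -/
theorem planar_erasure_accuracyThreshold_eq_half' : accuracyThreshold planarErasureFamily' = 1 / 2 := by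
  rw [planarErasureFamily'_eq]
  exact planar_erasure_accuracyThreshold_eq_half

/-- Census form, `Z`-sector of `fun k => planarHGPCode k`: loss threshold EXACTLY `1/2`. [cite: StaceBarrettDoherty2009, p. 1 (abstract)] -/
theorem planarHGP_z_erasure_accuracyThreshold_eq_half :
    accuracyThreshold (zErasureFamily (fun k => planarHGPCode k)) = 1 / 2 := by
  rw [zErasureFamily_planarHGPCode]
  exact planar_erasure_accuracyThreshold_eq_half

/-- Census form, `X`-sector of `fun k => planarHGPCode k`: loss threshold EXACTLY `1/2`. [cite: StaceBarrettDoherty2009, p. 1 (abstract)] -/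
theorem planarHGP_x_erasure_accuracyThreshold_eq_half :
    accuracyThreshold (xErasureFamily (fun k => planarHGPCode k)) = 1 / 2 := by
  rw [xErasureFamily_planarHGPCode, planarErasureFamily'_eq]
  exact planar_erasure_accuracyThreshold_eq_half

/-! ### Appended (qec-type-03 gen 5): the supercritical half and the decoder forms -/

/-- **At loss rate `1/2` a planar loss pattern is uncorrectable with probability `≥ 1/2`**, every size (no-cloning
identity `1 ≤ P_y + P'_{1-y}` and the sector symmetry `planar_xErasureFamily_eq`).
[cite: StaceBarrettDoherty2009, p. 2 (no-cloning bound on p_loss)] -/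
theorem planar_half_le_erasureFamily_half (k : ℕ) : 1 / 2 ≤ planarErasureFamily k (1 / 2) := by
  have h := (planarHGPCode k).one_le_uncorrectableProb_add (planarHGPCode_k_pos k) (y := 1 / 2) (by norm_num)
    (by norm_num)
  have hx := planar_xErasureFamily_eq k (1 - 1 / 2)
  change xErasureFamily (fun k => planarHGPCode k) k (1 - 1 / 2) = planarErasureFamily k (1 - 1 / 2) at hx
  change 1 ≤ planarErasureFamily k (1 / 2) + xErasureFamily (fun k => planarHGPCode k) k (1 - 1 / 2) at h
  rw [hx, show (1 : ℝ) - 1 / 2 = 1 / 2 by norm_num] at h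
  linarith

/-- **Above `1/2` planar loss recovery almost surely fails**: for `1/2 < y ≤ 1`, `P_y[loss pattern uncorrectable] → 1`
(no-cloning identity with the other sector at rate `1 - y < 1/2`, where `planar_lossThreshold_half` gives `→ 0`).
[cite: StaceBarrettDoherty2009, p. 3 (for p_loss > 0.5 loss recovery almost surely fails)] -/
theorem planar_loss_tendsto_one {y : ℝ} (hy : 1 / 2 < y) (hy1 : y ≤ 1) :
    Tendsto (fun k => planarErasureFamily k y) atTop (𝓝 1) := by
  have hy0 : 0 ≤ y := by linarith
  have hlow : ∀ k : ℕ, 1 - planarErasureFamily k (1 - y) ≤ planarErasureFamily k y := by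
    intro k
    have h := (planarHGPCode k).one_le_uncorrectableProb_add (planarHGPCode_k_pos k) (y := y) hy0 hy1
    have hx := planar_xErasureFamily_eq k (1 - y)
    change xErasureFamily (fun k => planarHGPCode k) k (1 - y) = planarErasureFamily k (1 - y) at hx
    change 1 ≤ planarErasureFamily k y + xErasureFamily (fun k => planarHGPCode k) k (1 - y) at h
    rw [hx] at h
    linarith
  have hup : ∀ k : ℕ, planarErasureFamily k y ≤ 1 := fun k => by
    classical
    unfold planarErasureFamily ErasureDecoder.uncorrectableProb
    exact eventProb_le_one _ hy0 hy1
  have h0 : Tendsto (fun k => planarErasureFamily k (1 - y)) atTop (𝓝 0) :=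
    planar_lossThreshold_half (1 - y) (by linarith) (by linarith)
  have h1 : Tendsto (fun k => 1 - planarErasureFamily k (1 - y)) atTop (𝓝 1) := by
    simpa using h0.const_sub 1
  exact tendsto_of_tendsto_of_tendsto_of_le_of_le h1 tendsto_const_nhds hlow hup

/-- **Decoder form**: for EVERY family of consistent loss decoders of the planar codes (maximum likelihood, peeling, …)
every loss rate `y < 1/2` is below threshold. [cite: StaceBarrettDoherty2009, p. 2–3] -/
theorem planarDecoder_lossThreshold_half (D : (k : ℕ) → ErasureDecoder (PlanarQubit k) (PlanarCheck k → ZMod 2))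
    (hD : ∀ k, (D k).IsConsistent (fun e => planarHX k *ᵥ e) {x | planarHX k *ᵥ x = 0}) :
    IsThresholdLowerBound
      (fun k y => (D k).failureProb (fun e => planarHX k *ᵥ e) (planarSZ k : Set (PlanarQubit k → ZMod 2)) y) (1 / 2) := by
  intro y hy0 hy
  have hy1 : y ≤ 1 := by linarith
  have h := planar_lossThreshold_half y hy0 hy
  exact BelowThreshold.of_le
    (P := fun k y => (D k).failureProb (fun e => planarHX k *ᵥ e) (planarSZ k : Set (PlanarQubit k → ZMod 2)) y) h
    (fun k => ErasureDecoder.failureProb_nonneg _ _ _ hy0 hy1)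
    (fun k => ErasureDecoder.failureProb_le_uncorrectableProb (hD k) _ hy0 hy1)

/-- **No loss-decoder family of the planar codes has a certified threshold above `1/2`** (every decoder fails on every
uncorrectable loss pattern, `ErasureDecoder.uncorrectableProb_le_failureProb`). [cite: StaceBarrettDoherty2009, p. 1 (maximum tolerable loss rate 50%)] -/
theorem planarDecoder_threshold_le_half (D : (k : ℕ) → ErasureDecoder (PlanarQubit k) (PlanarCheck k → ZMod 2)) {a : ℝ}
    (ha : IsThresholdLowerBound
      (fun k y => (D k).failureProb (fun e => planarHX k *ᵥ e) (planarSZ k : Set (PlanarQubit k → ZMod 2)) y) a) :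
    a ≤ 1 / 2 := by
  by_contra h
  push Not at h
  refine not_belowThreshold_of_le (c := 1 / 2) (by norm_num) (fun k => ?_) (ha (1 / 2) (by norm_num) h)
  calc (1 / 2 : ℝ) ≤ planarErasureFamily k (1 / 2) := planar_half_le_erasureFamily_half k
    _ ≤ (D k).failureProb (fun e => planarHX k *ᵥ e) (planarSZ k : Set (PlanarQubit k → ZMod 2)) (1 / 2) :=
        ErasureDecoder.uncorrectableProb_le_failureProb (D k) (planarSZ k)
          (fun x hx => by rw [show planarHX k *ᵥ x = 0 from hx, Matrix.mulVec_zero]) (by norm_num) (by norm_num)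

/-- ★ **Every consistent loss-decoder family of the planar surface codes has loss accuracy threshold EXACTLY `1/2`.**
[cite: StaceBarrettDoherty2009, p. 1 (abstract); DelfosseZemor2020, Lemma 1] -/
theorem planarDecoder_accuracyThreshold_eq_half (D : (k : ℕ) → ErasureDecoder (PlanarQubit k) (PlanarCheck k → ZMod 2))
    (hD : ∀ k, (D k).IsConsistent (fun e => planarHX k *ᵥ e) {x | planarHX k *ᵥ x = 0}) :
    accuracyThreshold
      (fun k y => (D k).failureProb (fun e => planarHX k *ᵥ e) (planarSZ k : Set (PlanarQubit k → ZMod 2)) y) = 1 / 2 :=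
  le_antisymm (planarDecoder_threshold_le_half D (isThresholdLowerBound_accuracyThreshold _))
    (le_accuracyThreshold (planarDecoder_lossThreshold_half D hD) (by norm_num))

/-! ### Appended (qec-type-03 gen 5): exponential decay below the loss threshold -/

open Classical in
/-- **Exponential decay below the planar loss threshold**: for every loss rate `0 ≤ y < 1/2` there are `C` and `r < 1` with
`P_y[loss pattern of the k-th planar code uncorrectable] ≤ C r^k` for all `k` — from the pointwise bound
`P ≤ (k+2) · P_y(0 ↔ ∂B(k+1)) ≤ (k+2) e^{-c(k+1)}` (Kesten/Menshikov decay) and `decaysExponentially_of_abs_le_poly_mul_exp`.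
[cite: KestenCMP1980, Thm. 2 (1.7)] [cite: StaceBarrettDoherty2009, p. 2–3] [cite: DennisEtAl2002, §5.3] -/
theorem planarErasureFamily_decaysExponentially {y : ℝ} (hy0 : 0 ≤ y) (hy : y < 1 / 2) :
    DecaysExponentially planarErasureFamily y := by
  have hy1 : y ≤ 1 := by linarith
  set p : unitInterval := ⟨y, hy0, hy1⟩ with hp
  obtain ⟨c, hc, hdec⟩ := Literature.Probability.Percolation.Kesten1980_expDecay p (by simpa [hp] using hy)
  refine decaysExponentially_of_abs_le_poly_mul_exp (B := 2) (m := 1) hc fun k => ?_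
  have hnn : 0 ≤ planarErasureFamily k y := ErasureDecoder.uncorrectableProb_nonneg _ _ hy0 hy1
  rw [abs_of_nonneg hnn]
  have h1 : planarErasureFamily k y ≤ eventProb (OddCrossing k) y := by
    unfold planarErasureFamily ErasureDecoder.uncorrectableProb
    exact eventProb_mono (fun Er hEr => oddCrossing_of_not_isCorrectableErasure k hEr) hy0 hy1
  have h2 : eventProb (OddCrossing k) y ≤ ((k : ℝ) + 2) * Real.exp (-c * ((k + 1 : ℕ) : ℝ)) :=
    (eventProb_oddCrossing_le k p).trans (mul_le_mul_of_nonneg_left (hdec _) (by positivity))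
  refine h1.trans (h2.trans ?_)
  have hk2 : (k : ℝ) + 2 ≤ 2 * ((k : ℝ) + 1) ^ 1 := by
    have : (0 : ℝ) ≤ (k : ℝ) := Nat.cast_nonneg k
    rw [pow_one]
    linarith
  have hexp : Real.exp (-c * ((k + 1 : ℕ) : ℝ)) ≤ Real.exp (-c * (k : ℝ)) :=
    Real.exp_le_exp.2 (by push_cast; nlinarith)
  exact mul_le_mul hk2 hexp (by positivity) (by positivity)

end Summit.Ventures.QEC.Thresholds
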